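import Mathlib
import Literature.NumberTheory.LFunctions.Zhang2022.Section6Statements
import Literature.NumberTheory.LFunctions.Zhang2022.Section5Lemma51
import HarnessLib

/-!
# Zhang (2022), §6 p. 32: the edge `DedEq61` — "the proof of (6.1) is therefore reduced to
# showing (6.3)" — PROVED

Topic `Literature/NumberTheory/LFunctions/Zhang2022` (Landau–Siegel audit tree; verdict-neutral).
Y. Zhang, *Discrete mean estimates and the Landau–Siegel zero*, arXiv:2211.02515v1 (2022)
[Zhang2022LandauSiegel] — **an unrefereed manuscript under adjudication; nothing in this file asserts
or denies its Theorems 1–2.** Campaign D-0069, discharge block F4 (L2), second half (the first half,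
`Z22:§6.u015`, is `Section6Step15.step6u015_holds`). The proof node of the proof of Lemma 6.1
(§6, PDF p. 32, tex L1754 of `lsz3__2_.tex`)

> whence (6.2) follows. The proof of (6.1) is therefore reduced to showing that [(6.3)]

is typed statement-exact as `Section6Statements.DedEq61 : Step6u009 → Eq62 → Eq63 → Eq61` (the
manuscript's deduction of (6.1) from the functional-equation split on `u = −1`, the tail bound (6.2)
and the segment formula (6.3)); it is PROVED here: `theorem dedEq61_holds : DedEq61` (kernel-checked,
no new facts, no hypotheses beyond the node's own), as the instance `E = E₁` of `dedEq61_of_error` — the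
same deduction for an arbitrary non-negative error functional `E(x,s)` in place of `E₁(s,ψ)` (the
`E`-term is carried additively), so that the reflected error term `E1main x (1 − s̄)` of G-d08-2
(`Section6IdoublePrime`, `Section6Lemma61Reflected`) is served by the same kernel argument.

What the printed sentence leaves implicit, and this file supplies:
* the line integral `(1/2πi)∫_{(−1)} L(s+w,ψ)P₄^wω₁(w)dw/w` splits into its `n < T³` and `n ≥ T³`
  parts — both integrands are continuous on `w = −1 + iv` and dominated by `B·e^{−v²/(8𝓛³⁰)}`
  (`d61_continuous_Zfac_line`, `d61_tailSum_line`, `d61_norm_headSum_le`, `d61_norm_kern_le`, `d61_line_sub_seg_le`);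
* the `n < T³` part of the integral on the two half-lines `u = −1`, `|v| > 𝓛²⁰` — silently dropped
  in print — is `≤ e^{−𝓛¹⁰/32}` for `𝓛 ≥ 100` (`d61_final_bound61`). The input is the size of the gamma
  factor on the WHOLE line `u = −1`, `d61_norm_Zfac_mul_gauss_le`:
  `|Z(s+w,ψ)|e^{(1−v²)/(4𝓛³⁰)} ≤ 4p²e^{1/(4𝓛³⁰)}(256𝓛¹⁰³⁸ + 32𝓛³⁰)e^{−v²/(8𝓛³⁰)}`, from
  `d61_norm_Zfac_le_stirling` (`|Z(σ′+iy,ψ)| ≤ 4p²y²` for `y ≥ 152`, by (2.4) `GammaFactor.Zfac_eq` and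
  the tree's Stirling formula `rsChi_stirling_of_abs_le` for `ϑ = χ` on `|σ′| ≤ 1`) and, for
  `Im(s+w) < 152` where `|v| ≥ t/2 ≥ 12π𝓛³⁰`, the crude bound `d61_norm_Zfac_le_crude`
  (`|Z(z,ψ)| ≤ p²e^{π|Im z|/2}` on `−3/4 ≤ Re z ≤ −1/4`, from the definition (2.2), `|τ(ψ)| = √p`,
  `|Γ| ≤ Γ(Re)`, convexity of `Γ` on `[1,2]` and the reflection formula) absorbed by `ω₁` — the
  "trivial bound for `ω₁(w)` and simple estimates" of the printed proof of (6.2), here on the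
  `n < T³` part.
Then `∫_{(−1)} + ZN = (2π)⁻¹(∫_ℝ − ∫_{−𝓛²⁰}^{𝓛²⁰})[n < T³] + (lhs63 + ZN) + (2π)⁻¹∫_ℝ[n ≥ T³]`, and
(6.2), (6.3) give (6.1) with `c = min(c₂, c₃, 1/32)`, `C = C₃⁺ + C₂⁺ + 1`, `D ≥ max(D₀, ⌈e¹⁰⁰⌉)`.

| DAG node | decl | status |
|---|---|---|
| `Z22:Lem6.1.pf` edge "(6.1) ⇐ FE-split + (6.2) + (6.3)" (p. 32, tex L1754) | `Section6Statements.dedEq61_holds : DedEq61` | PROVED |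

Deliberately NOT here: the leaves `Step6u009`, `Eq62`/`DedEq62` and the inputs of `Eq63` (other
seats); any claim about Theorems 1–2 of the source.

## References

* Y. Zhang, arXiv:2211.02515v1 (2022), §6 p. 31–32 (proof of Lemma 6.1, (6.1)–(6.3) and the
  sentences around (6.2)); §2 (2.2), (2.4) (`Z(s,θ)`); §4 p. 18–19 (`ω₁`, `ε`).
  [cite: Zhang2022LandauSiegel, §6 p.32 tex L1754]
* E. C. Titchmarsh, *The Theory of the Riemann Zeta-Function*, 2nd ed. (OUP 1986), §4.12 (4.12.3)
  (Stirling for `χ(s)` in a fixed strip) — consumed through the tree's `RiemannSiegelChiStirling`.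
  [cite: Titchmarsh1986, §4.12 (4.12.3)]
-/

noncomputable section

open Complex Real Set MeasureTheory

namespace Literature.NumberTheory.LFunctions.Zhang2022.Section6Statements

open Skeleton GaussWeight

/-! ## Parameter bookkeeping (local copies of the helpers of `Section6Step15`) -/

/-- `−1 + iv ≠ 0`. [folklore] -/
private theorem d61_neg_one_add_ne_zero (v : ℝ) : (-1 : ℂ) + v * I ≠ 0 := by
  intro h
  have := congrArg Complex.re h
  simp at this

/-- `𝓛 ≥ 3` once `D ≥ ⌈e³⌉`. [cite: Zhang2022LandauSiegel, §2 (2.1)] -/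
private theorem d61_three_le_ell {D : ℕ} (hD : ⌈Real.exp 3⌉₊ ≤ D) : 3 ≤ ell D := by
  have h : Real.exp 3 ≤ D := le_trans (Nat.le_ceil _) (by exact_mod_cast hD)
  exact (Real.le_log_iff_exp_le (lt_of_lt_of_le (Real.exp_pos _) h)).mpr h

/-- `2α = 2π𝓛⁻⁹ ≤ 1/4` for `𝓛 ≥ 3`. [cite: Zhang2022LandauSiegel, §2 (2.10)] -/
private theorem d61_two_alpha_le_quarter {D : ℕ} (hL : 3 ≤ ell D) : 2 * alpha D ≤ 1 / 4 := by
  have hα : alpha D = π / ell D ^ 9 := by rw [alpha, bigP, Real.log_exp]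
  have hL9 : (3 : ℝ) ^ 9 ≤ ell D ^ 9 := pow_le_pow_left₀ (by norm_num) hL 9
  rw [hα, mul_div_assoc', div_le_iff₀ (by positivity)]
  nlinarith [Real.pi_lt_four]

/-- The window `p ∼ P`: `P < p < P(1 + 𝓛⁻⁶⁸)`. [cite: Zhang2022LandauSiegel, §2 p. 4] -/
private theorem d61_prime_window {D : ℕ} (x : Chr D) :
    bigP D < x.p ∧ (x.p : ℝ) < bigP D * (1 + (ell D ^ 68)⁻¹) := by
  have hm := x.mem
  rw [primeWindow, Finset.mem_filter, Finset.mem_Ioo] at hm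
  have hP : 0 ≤ bigP D := (Real.exp_pos _).le
  exact ⟨(Nat.floor_lt hP).mp hm.1.1, Nat.lt_ceil.mp hm.1.2⟩

/-- The `t`-range `|t − 2πt₀| < 𝓛₁ + 2` gives `5𝓛⁵¹⁹ ≤ t ≤ 8𝓛⁵¹⁹`.
[cite: Zhang2022LandauSiegel, §2 (2.8)] -/
private theorem d61_t_range_519 {L t : ℝ} (hL : 3 ≤ L) (ht : |t - 2 * π * L ^ 519| < L ^ 405 + 2) :
    5 * L ^ 519 ≤ t ∧ t ≤ 8 * L ^ 519 := by
  have hL1 : 1 ≤ L := by linarith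
  have hL0 : 0 < L := by linarith
  have h114 : 9 ≤ L ^ 114 := by
    have h : L ^ 2 ≤ L ^ 114 := pow_le_pow_right₀ hL1 (by norm_num)
    nlinarith
  have h405 : L ^ 405 + 2 ≤ L ^ 519 := by
    have h1 : (1 : ℝ) ≤ L ^ 405 := one_le_pow₀ hL1
    calc L ^ 405 + 2 ≤ L ^ 405 * 9 := by nlinarith
      _ ≤ L ^ 405 * L ^ 114 := by gcongr
      _ = L ^ 519 := by rw [← pow_add]
  obtain ⟨ht1, ht2⟩ := abs_lt.mp ht
  have hπa : 3 * L ^ 519 ≤ π * L ^ 519 :=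
    mul_le_mul_of_nonneg_right Real.pi_gt_three.le (by positivity)
  have hπb : π * L ^ 519 ≤ 3.15 * L ^ 519 :=
    mul_le_mul_of_nonneg_right Real.pi_lt_d2.le (by positivity)
  exact ⟨by linarith, by linarith⟩

/-! ## H. The gamma factor `Z(s+w,ψ)` on the whole line `u = −1` (for the edge `DedEq61`) -/

/-- `cosh x ≤ e^{|x|}`. [folklore] -/
private theorem d61_cosh_le_exp_abs (x : ℝ) : Real.cosh x ≤ Real.exp |x| := by
  rw [Real.cosh_eq]
  have h1 : Real.exp x ≤ Real.exp |x| := Real.exp_le_exp.mpr (le_abs_self x)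
  have h2 : Real.exp (-x) ≤ Real.exp |x| := Real.exp_le_exp.mpr (neg_le_abs x)
  linarith

/-- `|sin z| ≤ e^{|Im z|}`. [folklore] -/
private theorem d61_norm_sin_le_exp_abs_im (z : ℂ) : ‖Complex.sin z‖ ≤ Real.exp |z.im| := by
  have h := Literature.Analysis.SpecialFunctions.GammaVert.norm_cos_le_cosh_im (π / 2 - z)
  rw [Complex.cos_pi_div_two_sub] at h
  have him : ((π : ℂ) / 2 - z).im = -z.im := by simp
  rw [him, Real.cosh_neg] at h
  exact h.trans (d61_cosh_le_exp_abs _)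

/-- `‖Γ(s)‖ ≤ 1` for `1 ≤ Re s ≤ 2` (`‖Γ(s)‖ ≤ Γ(Re s)` and convexity, `Γ(1) = Γ(2) = 1`).
[folklore] -/
private theorem d61_norm_Gamma_le_one {s : ℂ} (hs1 : 1 ≤ s.re) (hs2 : s.re ≤ 2) :
    ‖Complex.Gamma s‖ ≤ 1 := by
  have h := Literature.Analysis.SpecialFunctions.GammaVert.norm_Gamma_le_Gamma_re
    (x := s.re) (by linarith) s.im
  rw [Complex.re_add_im] at h
  refine h.trans ?_
  have hc := Real.convexOn_Gamma.le_max_of_mem_Icc (x := 1) (y := 2) (z := s.re)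
    (by simp) (by simp) ⟨hs1, hs2⟩
  rwa [Real.Gamma_one, Real.Gamma_two, max_self] at hc

/-- `‖Γ(s)‖ ≤ 8/5` for `5/8 ≤ Re s ≤ 1` (`Γ(s) = Γ(s+1)/s`). [folklore] -/
private theorem d61_norm_Gamma_le_of_re_ge {s : ℂ} (hs1 : 5 / 8 ≤ s.re) (hs2 : s.re ≤ 1) :
    ‖Complex.Gamma s‖ ≤ 8 / 5 := by
  have hns : 5 / 8 ≤ ‖s‖ := hs1.trans (Complex.re_le_norm s)
  have hs' : 0 < ‖s‖ := by linarith
  have hs0 : s ≠ 0 := norm_pos_iff.mp hs'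
  have h := Complex.Gamma_add_one s hs0
  have h1 : ‖Complex.Gamma (s + 1)‖ ≤ 1 :=
    d61_norm_Gamma_le_one (by simp; linarith) (by simp; linarith)
  rw [h, norm_mul] at h1
  calc ‖Complex.Gamma s‖ = (‖s‖ * ‖Complex.Gamma s‖) / ‖s‖ := by field_simp
    _ ≤ 1 / (5 / 8) := div_le_div₀ zero_le_one h1 (by norm_num) hns
    _ = 8 / 5 := by norm_num

/-- Reflection: `‖Γ(s)⁻¹‖ ≤ ‖Γ(1−s)‖·e^{π|Im s|}/π` when `sin(πs) ≠ 0`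
(`Γ(s)Γ(1−s) = π/sin(πs)`, `|sin z| ≤ e^{|Im z|}`). [folklore] -/
private theorem d61_norm_Gamma_inv_le {s : ℂ} (hsin : Complex.sin (π * s) ≠ 0) :
    ‖(Complex.Gamma s)⁻¹‖ ≤ ‖Complex.Gamma (1 - s)‖ * Real.exp (π * |s.im|) / π := by
  have hπ : (π : ℂ) ≠ 0 := ofReal_ne_zero.mpr Real.pi_ne_zero
  have h := Complex.Gamma_mul_Gamma_one_sub s
  have hG : Complex.Gamma s ≠ 0 := by
    intro h0
    rw [h0, zero_mul] at h
    exact hπ (by simpa [hsin] using (div_eq_zero_iff.mp h.symm))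
  have hinv : (Complex.Gamma s)⁻¹ = Complex.Gamma (1 - s) * Complex.sin (π * s) / π := by
    refine inv_eq_of_mul_eq_one_right ?_
    rw [mul_div_assoc', ← mul_assoc, h]
    field_simp
  rw [hinv, norm_div, norm_mul, Complex.norm_real, Real.norm_of_nonneg Real.pi_pos.le]
  have hsinle : ‖Complex.sin (π * s)‖ ≤ Real.exp (π * |s.im|) := by
    have h1 := d61_norm_sin_le_exp_abs_im (π * s)
    have him : ((π : ℂ) * s).im = π * s.im := by simp
    rw [him, abs_mul, abs_of_pos Real.pi_pos] at h1
    exact h1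
  gcongr

/-- No integers in a strip: if `a ≤ Re s ≤ b` with `n < a`, `b < n + 1` for an integer `n`, then
`sin(πs) ≠ 0`. [folklore] -/
private theorem d61_sin_pi_mul_ne_zero_of_re {s : ℂ} {a b : ℝ} {n : ℤ} (ha : a ≤ s.re) (hb : s.re ≤ b)
    (hn : (n : ℝ) < a) (hn1 : b < n + 1) : Complex.sin (π * s) ≠ 0 := by
  intro h
  obtain ⟨m, hm⟩ := Complex.sin_eq_zero_iff.mp h
  have hπ : (π : ℂ) ≠ 0 := ofReal_ne_zero.mpr Real.pi_ne_zero
  have hs : s = m := by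
    have := hm
    field_simp at this
    linear_combination this
  have hre : s.re = m := by rw [hs]; simp
  rw [hre] at ha hb
  have h1 : n < m := by exact_mod_cast hn.trans_le ha
  have h2 : m < n + 1 := by exact_mod_cast hb.trans_lt hn1
  omega

/-- **Crude size of `Z` left of the critical strip**: for `θ` primitive mod `k` and
`−3/4 ≤ Re z ≤ −1/4`, `|Z(z,θ)| ≤ k²e^{π|Im z|/2}` — from the definition (2.2)
(`|τ(θ)| = √k`, `|π^{z−1/2}| ≤ 1`, `|k^{−z}| ≤ k`, `|Γ| ≤ 8/5` on `5/8 ≤ Re ≤ 1`, `|Γ| ≤ 1` on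
`1 ≤ Re ≤ 2`, reflection for the reciprocal). [cite: Zhang2022LandauSiegel, §2 (2.2)] -/
private theorem d61_norm_Zfac_le_crude {k : ℕ} [NeZero k] {θ : DirichletCharacter ℂ k}
    (hθ : θ.IsPrimitive) {z : ℂ} (hz1 : -(3 / 4 : ℝ) ≤ z.re) (hz2 : z.re ≤ -(1 / 4 : ℝ)) :
    ‖GammaFactor.Zfac θ z‖ ≤ (k : ℝ) ^ 2 * Real.exp (π * |z.im| / 2) := by
  have hk0 : 0 < k := Nat.pos_of_ne_zero (NeZero.ne k)
  have hk1 : (1 : ℝ) ≤ k := by exact_mod_cast hk0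
  have hτ : ‖GammaFactor.tau θ‖ ≤ k := by
    rw [GammaFactor.norm_tau hθ]
    exact Real.sqrt_le_iff.mpr ⟨by positivity, by nlinarith⟩
  have hπz : ‖(π : ℂ) ^ (z - 1 / 2)‖ ≤ 1 := by
    rw [Complex.norm_cpow_eq_rpow_re_of_pos Real.pi_pos]
    refine Real.rpow_le_one_of_one_le_of_nonpos (by linarith [Real.pi_gt_three]) ?_
    simp; linarith
  have hkz : ‖(k : ℂ) ^ (-z)‖ ≤ k := by
    rw [Complex.norm_natCast_cpow_of_pos hk0]
    calc (k : ℝ) ^ (-z).re ≤ (k : ℝ) ^ (1 : ℝ) :=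
          Real.rpow_le_rpow_of_exponent_le hk1 (by simp; linarith)
      _ = k := Real.rpow_one _
  have hexp : 0 < Real.exp (π * |z.im| / 2) := Real.exp_pos _
  have h85 : 8 / 5 * (Real.exp (π * |z.im| / 2) / π) ≤ Real.exp (π * |z.im| / 2) := by
    rw [← mul_div_assoc, div_le_iff₀ Real.pi_pos]
    nlinarith [Real.pi_gt_three]
  unfold GammaFactor.Zfac
  split_ifs with hev
  · -- even: `τ π^{z−1/2} k^{−z} Γ((1−z)/2) Γ(z/2)⁻¹`
    have hG1 : ‖Complex.Gamma ((1 - z) / 2)‖ ≤ 8 / 5 :=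
      d61_norm_Gamma_le_of_re_ge (by simp; linarith) (by simp; linarith)
    have hsin : Complex.sin (π * (z / 2)) ≠ 0 :=
      d61_sin_pi_mul_ne_zero_of_re (a := -(3 / 8)) (b := -(1 / 8)) (n := -1)
        (by simp; linarith) (by simp; linarith) (by norm_num) (by norm_num)
    have hG2 : ‖(Complex.Gamma (z / 2))⁻¹‖ ≤ Real.exp (π * |z.im| / 2) / π := by
      refine (d61_norm_Gamma_inv_le hsin).trans ?_
      have h1 : ‖Complex.Gamma (1 - z / 2)‖ ≤ 1 :=
        d61_norm_Gamma_le_one (by simp; linarith) (by simp; linarith)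
      have him : |(z / 2).im| = |z.im| / 2 := by
        rw [Complex.div_ofNat_im, abs_div, abs_two]
      rw [him, show π * (|z.im| / 2) = π * |z.im| / 2 by ring]
      gcongr
      · calc ‖Complex.Gamma (1 - z / 2)‖ * Real.exp (π * |z.im| / 2)
            ≤ 1 * Real.exp (π * |z.im| / 2) := by gcongr
          _ = Real.exp (π * |z.im| / 2) := one_mul _
    calc ‖GammaFactor.tau θ * (π : ℂ) ^ (z - 1 / 2) * (k : ℂ) ^ (-z) *
            Complex.Gamma ((1 - z) / 2) * (Complex.Gamma (z / 2))⁻¹‖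
        = ‖GammaFactor.tau θ‖ * ‖(π : ℂ) ^ (z - 1 / 2)‖ * ‖(k : ℂ) ^ (-z)‖ *
            ‖Complex.Gamma ((1 - z) / 2)‖ * ‖(Complex.Gamma (z / 2))⁻¹‖ := by
          simp only [norm_mul]
      _ ≤ k * 1 * k * (8 / 5) * (Real.exp (π * |z.im| / 2) / π) := by
          gcongr
      _ = (k : ℝ) ^ 2 * (8 / 5 * (Real.exp (π * |z.im| / 2) / π)) := by ring
      _ ≤ (k : ℝ) ^ 2 * Real.exp (π * |z.im| / 2) := by gcongr
  · -- odd: `−i τ π^{z−1/2} k^{−z} Γ((2−z)/2) Γ((1+z)/2)⁻¹`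
    have hG1 : ‖Complex.Gamma ((2 - z) / 2)‖ ≤ 1 :=
      d61_norm_Gamma_le_one (by simp; linarith) (by simp; linarith)
    have hsin : Complex.sin (π * ((1 + z) / 2)) ≠ 0 :=
      d61_sin_pi_mul_ne_zero_of_re (a := 1 / 8) (b := 3 / 8) (n := 0)
        (by simp; linarith) (by simp; linarith) (by norm_num) (by norm_num)
    have hG2 : ‖(Complex.Gamma ((1 + z) / 2))⁻¹‖ ≤ 8 / 5 * (Real.exp (π * |z.im| / 2) / π) := by
      refine (d61_norm_Gamma_inv_le hsin).trans ?_
      have h1 : ‖Complex.Gamma (1 - (1 + z) / 2)‖ ≤ 8 / 5 :=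
        d61_norm_Gamma_le_of_re_ge (by simp; linarith) (by simp; linarith)
      have him : |((1 + z) / 2).im| = |z.im| / 2 := by
        rw [Complex.div_ofNat_im]; simp [abs_div]
      rw [him, show π * (|z.im| / 2) = π * |z.im| / 2 by ring, mul_div_assoc]
      gcongr
    calc ‖-I * GammaFactor.tau θ * (π : ℂ) ^ (z - 1 / 2) * (k : ℂ) ^ (-z) *
            Complex.Gamma ((2 - z) / 2) * (Complex.Gamma ((1 + z) / 2))⁻¹‖
        = ‖GammaFactor.tau θ‖ * ‖(π : ℂ) ^ (z - 1 / 2)‖ * ‖(k : ℂ) ^ (-z)‖ *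
            ‖Complex.Gamma ((2 - z) / 2)‖ * ‖(Complex.Gamma ((1 + z) / 2))⁻¹‖ := by
          simp only [norm_mul, norm_neg, Complex.norm_I, one_mul]
      _ ≤ k * 1 * k * 1 * (8 / 5 * (Real.exp (π * |z.im| / 2) / π)) := by
          gcongr
      _ = (k : ℝ) ^ 2 * (8 / 5 * (Real.exp (π * |z.im| / 2) / π)) := by ring
      _ ≤ (k : ℝ) ^ 2 * Real.exp (π * |z.im| / 2) := by gcongr

/-- **Polynomial size of `Z` left of the critical strip, far from the real axis** (Stirling): for
`θ` primitive mod `k`, `−1 ≤ σ′ ≤ 0` and `y ≥ 152`, `|Z(σ′+iy,θ)| ≤ 4k²y²` — by (2.4)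
(`GammaFactor.Zfac_eq`: `Z = θ(−1)τ(θ)k^{−z}ϑ(z)(1+r)`, `|r| ≤ 3e^{−πy}`) and the tree's Stirling
formula for `ϑ = χ` on `|σ′| ≤ 1` (`rsChi_stirling_of_abs_le`: `|χ(σ′+iy)| ≤ 2(y/2π)^{1/2−σ′}`).
[cite: Zhang2022LandauSiegel, §2 (2.4); Titchmarsh1986, §4.12 (4.12.3)] -/
private theorem d61_norm_Zfac_le_stirling {k : ℕ} [NeZero k] {θ : DirichletCharacter ℂ k}
    (hθ : θ.IsPrimitive) {σ' y : ℝ} (hσ1 : -1 ≤ σ') (hσ2 : σ' ≤ 0) (hy : 152 ≤ y) :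
    ‖GammaFactor.Zfac θ ((σ' : ℂ) + y * I)‖ ≤ 4 * (k : ℝ) ^ 2 * y ^ 2 := by
  have hk0 : 0 < k := Nat.pos_of_ne_zero (NeZero.ne k)
  have hk1 : (1 : ℝ) ≤ k := by exact_mod_cast hk0
  have hy0 : 0 < y := by linarith
  have him : 0 < ((σ' : ℂ) + y * I).im := by simpa using hy0
  have him1 : 1 ≤ ((σ' : ℂ) + y * I).im := by simp; linarith
  rw [GammaFactor.Zfac_eq θ him, GammaFactor.vartheta_eq_rsChi him.ne']
  -- Stirling for `χ` on `|σ′| ≤ 1`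
  obtain ⟨η, hη, hst⟩ := rsChi_stirling_of_abs_le (A := 1) (σ := σ') (t := y) le_rfl
    (abs_le.mpr ⟨by linarith, by linarith⟩) (by norm_num; linarith)
  have hη1 : ‖η‖ ≤ 1 := hη.trans (by rw [div_le_one hy0]; norm_num; linarith)
  have hrs : ‖SiegelIntegral.rsChi ((σ' : ℂ) + y * I)‖ ≤ 2 * y ^ 2 := by
    have hphase : ‖cexp ((π / 4 + y - y * Real.log (y / (2 * π))) * I)‖ = 1 := by
      have h := Complex.norm_exp_ofReal_mul_I (π / 4 + y - y * Real.log (y / (2 * π)))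
      push_cast at h
      exact h
    have hbase1 : 1 ≤ y / (2 * π) := by
      rw [le_div_iff₀ (by positivity)]; nlinarith [Real.pi_lt_four]
    have hbase2 : y / (2 * π) ≤ y := by
      rw [div_le_iff₀ (by positivity)]; nlinarith [Real.pi_gt_three]
    have hpow : (y / (2 * π)) ^ (1 / 2 - σ') ≤ y ^ 2 := by
      calc (y / (2 * π)) ^ (1 / 2 - σ') ≤ (y / (2 * π)) ^ (2 : ℝ) :=
            Real.rpow_le_rpow_of_exponent_le hbase1 (by linarith)
        _ = (y / (2 * π)) ^ 2 := Real.rpow_two _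
        _ ≤ y ^ 2 := pow_le_pow_left₀ (by positivity) hbase2 2
    have hpos : 0 ≤ (y / (2 * π)) ^ (1 / 2 - σ') := Real.rpow_nonneg (by positivity) _
    rw [hst, norm_mul, norm_mul, hphase, mul_one, Complex.norm_real, Real.norm_of_nonneg hpos]
    have h1η : ‖1 + η‖ ≤ 2 := (norm_add_le _ _).trans (by rw [norm_one]; linarith)
    calc (y / (2 * π)) ^ (1 / 2 - σ') * ‖1 + η‖ ≤ y ^ 2 * 2 :=
          mul_le_mul hpow h1η (norm_nonneg _) (by positivity)
      _ = 2 * y ^ 2 := by ring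
  have h1 : ‖θ (-1)‖ = 1 := GammaFactor.norm_apply_neg_one θ
  have hτ : ‖GammaFactor.tau θ‖ ≤ k := by
    rw [GammaFactor.norm_tau hθ]
    exact Real.sqrt_le_iff.mpr ⟨by positivity, by nlinarith⟩
  have hkz : ‖(k : ℂ) ^ (-((σ' : ℂ) + y * I))‖ ≤ k := by
    rw [GammaFactor.norm_natCast_cpow_neg]
    calc (k : ℝ) ^ (-σ') ≤ (k : ℝ) ^ (1 : ℝ) := Real.rpow_le_rpow_of_exponent_le hk1 (by linarith)
      _ = k := Real.rpow_one _
  have hcorr : ‖1 + GammaFactor.corr θ ((σ' : ℂ) + y * I)‖ ≤ 2 := by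
    have hc := GammaFactor.norm_corr_le θ him1
    have he : Real.exp (-π * ((σ' : ℂ) + y * I).im) ≤ 1 / 3 := by
      have him' : ((σ' : ℂ) + y * I).im = y := by simp
      rw [him']
      exact GammaFactor.exp_neg_pi_mul_le (by linarith)
    calc ‖1 + GammaFactor.corr θ ((σ' : ℂ) + y * I)‖
        ≤ ‖(1 : ℂ)‖ + ‖GammaFactor.corr θ ((σ' : ℂ) + y * I)‖ := norm_add_le _ _
      _ ≤ 1 + 3 * (1 / 3) := by rw [norm_one]; linarith
      _ = 2 := by norm_num
  calc ‖θ (-1) * GammaFactor.tau θ * (k : ℂ) ^ (-((σ' : ℂ) + y * I)) *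
          SiegelIntegral.rsChi ((σ' : ℂ) + y * I) * (1 + GammaFactor.corr θ ((σ' : ℂ) + y * I))‖
      = ‖θ (-1)‖ * ‖GammaFactor.tau θ‖ * ‖(k : ℂ) ^ (-((σ' : ℂ) + y * I))‖ *
          ‖SiegelIntegral.rsChi ((σ' : ℂ) + y * I)‖ *
          ‖1 + GammaFactor.corr θ ((σ' : ℂ) + y * I)‖ := by simp only [norm_mul]
    _ ≤ 1 * k * k * (2 * y ^ 2) * 2 := by
        rw [h1]
        gcongr
    _ = 4 * (k : ℝ) ^ 2 * y ^ 2 := by ring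

/-- `v²e^{−v²/(8Λ)} ≤ 8Λ` (`ue^{−u} ≤ 1`). [folklore] -/
private theorem d61_sq_mul_exp_le {Λ : ℝ} (hΛ : 0 < Λ) (v : ℝ) :
    v ^ 2 * Real.exp (-(1 / (8 * Λ)) * v ^ 2) ≤ 8 * Λ := by
  set u : ℝ := v ^ 2 / (8 * Λ) with hu
  have hu0 : 0 ≤ u := by positivity
  have h1 : u ≤ Real.exp u := by linarith [Real.add_one_le_exp u]
  have h2 : u * Real.exp (-u) ≤ 1 := by
    calc u * Real.exp (-u) ≤ Real.exp u * Real.exp (-u) :=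
          mul_le_mul_of_nonneg_right h1 (Real.exp_pos _).le
      _ = 1 := by rw [← Real.exp_add, add_neg_cancel, Real.exp_zero]
  have h3 : v ^ 2 * Real.exp (-(1 / (8 * Λ)) * v ^ 2) = 8 * Λ * (u * Real.exp (-u)) := by
    rw [hu, show -(1 / (8 * Λ)) * v ^ 2 = -(v ^ 2 / (8 * Λ)) by ring]
    field_simp
  rw [h3]
  nlinarith

set_option maxHeartbeats 400000 in
/-- **The size of `Z(s+w,ψ)ω₁(w)` on the whole line `u = −1`**: for `D ≥ ⌈e³⌉`, `ψ ∈ Ψ`, `s` in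
the range of Lemma 6.1 and every real `v` (`w = −1 + iv`),
`|Z(s+w,ψ)|·e^{(1−v²)/(4𝓛³⁰)} ≤ 4p²e^{1/(4𝓛³⁰)}(256𝓛¹⁰³⁸ + 32𝓛³⁰)·e^{−v²/(8𝓛³⁰)}`:
for `Im(s+w) ≥ 152` by Stirling (`d61_norm_Zfac_le_stirling`, `(t+v)² ≤ 2t² + 2v²`, `t ≤ 8𝓛⁵¹⁹`,
`v²e^{−v²/(8Λ)} ≤ 8Λ`); for `Im(s+w) < 152` one has `|v| ≥ t/2 ≥ 12π𝓛³⁰` and the crude bound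
`p²e^{3π|v|/2}` (`d61_norm_Zfac_le_crude`) is absorbed by `e^{−v²/(8𝓛³⁰)}` — the "trivial bound for
`ω₁(w)`" of the printed proof of (6.2), here on the `n < T³` part.
[cite: Zhang2022LandauSiegel, §6 p.32, tex L1746–1754] -/
private theorem d61_norm_Zfac_mul_gauss_le {D : ℕ} (hD : ⌈Real.exp 3⌉₊ ≤ D) (x : Chr D) {s : ℂ}
    (hs : InRange61 D s) (v : ℝ) :
    ‖GammaFactor.Zfac x.ψ (s + ((-1 : ℂ) + v * I))‖ * Real.exp ((1 - v ^ 2) / (4 * ell D ^ 30))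
      ≤ 4 * (x.p : ℝ) ^ 2 * Real.exp (1 / (4 * ell D ^ 30)) *
          (256 * ell D ^ 1038 + 32 * ell D ^ 30) * Real.exp (-(1 / (8 * ell D ^ 30)) * v ^ 2) := by
  have hL3 : 3 ≤ ell D := d61_three_le_ell hD
  have hL0 : 0 < ell D := by linarith
  have hL1 : 1 ≤ ell D := by linarith
  set Λ : ℝ := ell D ^ 30 with hΛdef
  have hΛ : 0 < Λ := by positivity
  have hΛ1 : 1 ≤ Λ := one_le_pow₀ hL1
  obtain ⟨σ, t, rfl⟩ : ∃ σ' t' : ℝ, s = σ' + t' * I := ⟨s.re, s.im, (re_add_im s).symm⟩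
  obtain ⟨hσ, htr⟩ := hs
  have hσ' : |σ - 1 / 2| < 2 * alpha D := by simpa using hσ
  have htr' : |t - 2 * π * ell D ^ 519| < ell D ^ 405 + 2 := by
    have h := htr
    rw [ell1, t0] at h
    simpa using h
  obtain ⟨ht5, ht8⟩ := d61_t_range_519 hL3 htr'
  have hσ4 : |σ - 1 / 2| ≤ 1 / 4 := hσ'.le.trans (d61_two_alpha_le_quarter hL3)
  obtain ⟨hσa, hσb⟩ := abs_le.mp hσ4
  have h519 : (3 : ℝ) ≤ ell D ^ 519 := hL3.trans (le_self_pow₀ hL1 (by norm_num))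
  have ht0 : 0 < t := by linarith
  have hp0 : (0 : ℝ) < x.p := by exact_mod_cast x.prime.pos
  -- the point `s + w = (σ − 1) + i(t + v)`
  have hpt : (σ : ℂ) + t * I + ((-1 : ℂ) + v * I) = ((σ - 1 : ℝ) : ℂ) + ((t + v : ℝ) : ℂ) * I := by
    push_cast; ring
  rw [hpt]
  -- the Gaussian bookkeeping
  have hsplit : Real.exp ((1 - v ^ 2) / (4 * Λ))
      = Real.exp (1 / (4 * Λ)) * Real.exp (-(1 / (8 * Λ)) * v ^ 2) *
          Real.exp (-(1 / (8 * Λ)) * v ^ 2) := by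
    rw [← Real.exp_add, ← Real.exp_add]
    congr 1
    field_simp
    ring
  have h519b : (100 : ℝ) ≤ ell D ^ 519 := by
    have h1 : (3 : ℝ) ^ 5 ≤ ell D ^ 5 := pow_le_pow_left₀ (by norm_num) hL3 5
    have h2 : ell D ^ 5 ≤ ell D ^ 519 := pow_le_pow_right₀ hL1 (by norm_num)
    nlinarith
  have hK1 : (1 : ℝ) ≤ 256 * ell D ^ 1038 + 32 * Λ := by nlinarith [one_le_pow₀ hL1 (n := 1038)]
  have ht2 : 2 * (t + v) ^ 2 * Real.exp (-(1 / (8 * Λ)) * v ^ 2) ≤ 256 * ell D ^ 1038 + 32 * Λ := by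
    have h1 : (t + v) ^ 2 ≤ 2 * t ^ 2 + 2 * v ^ 2 := by nlinarith [sq_nonneg (t - v)]
    have h2 : t ^ 2 ≤ 64 * ell D ^ 1038 := by
      have : ell D ^ 1038 = (ell D ^ 519) ^ 2 := by rw [← pow_mul]
      rw [this]; nlinarith
    have he1 : Real.exp (-(1 / (8 * Λ)) * v ^ 2) ≤ 1 := by
      rw [Real.exp_le_one_iff]
      have : 0 ≤ 1 / (8 * Λ) * v ^ 2 := by positivity
      linarith
    have h3 := d61_sq_mul_exp_le hΛ v
    have he0 : 0 ≤ Real.exp (-(1 / (8 * Λ)) * v ^ 2) := (Real.exp_pos _).le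
    calc 2 * (t + v) ^ 2 * Real.exp (-(1 / (8 * Λ)) * v ^ 2)
        ≤ 2 * (2 * t ^ 2 + 2 * v ^ 2) * Real.exp (-(1 / (8 * Λ)) * v ^ 2) := by gcongr
      _ = 4 * t ^ 2 * Real.exp (-(1 / (8 * Λ)) * v ^ 2) +
            4 * (v ^ 2 * Real.exp (-(1 / (8 * Λ)) * v ^ 2)) := by ring
      _ ≤ 4 * t ^ 2 * 1 + 4 * (8 * Λ) := by gcongr
      _ ≤ 256 * ell D ^ 1038 + 32 * Λ := by nlinarith
  rcases le_or_gt 152 (t + v) with hreg | hreg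
  · -- Stirling region `Im(s+w) ≥ 152`
    have hZ := d61_norm_Zfac_le_stirling x.prim (σ' := σ - 1) (y := t + v) (by linarith) (by linarith) hreg
    rw [hsplit]
    calc ‖GammaFactor.Zfac x.ψ (((σ - 1 : ℝ) : ℂ) + ((t + v : ℝ) : ℂ) * I)‖ *
          (Real.exp (1 / (4 * Λ)) * Real.exp (-(1 / (8 * Λ)) * v ^ 2) *
            Real.exp (-(1 / (8 * Λ)) * v ^ 2))
        ≤ (4 * (x.p : ℝ) ^ 2 * (t + v) ^ 2) *
          (Real.exp (1 / (4 * Λ)) * Real.exp (-(1 / (8 * Λ)) * v ^ 2) *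
            Real.exp (-(1 / (8 * Λ)) * v ^ 2)) := by gcongr
      _ = 2 * (x.p : ℝ) ^ 2 * Real.exp (1 / (4 * Λ)) *
            (2 * (t + v) ^ 2 * Real.exp (-(1 / (8 * Λ)) * v ^ 2)) *
            Real.exp (-(1 / (8 * Λ)) * v ^ 2) := by ring
      _ ≤ 2 * (x.p : ℝ) ^ 2 * Real.exp (1 / (4 * Λ)) * (256 * ell D ^ 1038 + 32 * Λ) *
            Real.exp (-(1 / (8 * Λ)) * v ^ 2) := by gcongr
      _ ≤ 4 * (x.p : ℝ) ^ 2 * Real.exp (1 / (4 * Λ)) * (256 * ell D ^ 1038 + 32 * Λ) *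
            Real.exp (-(1 / (8 * Λ)) * v ^ 2) := by
          gcongr
          nlinarith [sq_nonneg (x.p : ℝ), (Real.exp_pos (1 / (4 * Λ))).le,
            mul_nonneg (mul_nonneg (sq_nonneg (x.p : ℝ)) (Real.exp_pos (1 / (4 * Λ))).le)
              (by positivity : (0 : ℝ) ≤ 256 * ell D ^ 1038 + 32 * Λ)]
  · -- crude region `Im(s+w) < 152`: `|v| ≥ t/2 ≥ 12πΛ`
    have hv : t / 2 ≤ |v| := by
      have h304 : (304 : ℝ) ≤ t := by linarith
      have hvneg : v < 0 := by linarith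
      rw [abs_of_neg hvneg]; linarith
    have hy : |t + v| ≤ 3 * |v| := by
      rw [abs_le]
      have h1 := neg_abs_le v
      have h2 := le_abs_self v
      constructor
      · linarith
      · linarith
    have hZ := d61_norm_Zfac_le_crude x.prim (z := ((σ - 1 : ℝ) : ℂ) + ((t + v : ℝ) : ℂ) * I)
      (by simp; linarith) (by simp; linarith)
    have him : (((σ - 1 : ℝ) : ℂ) + ((t + v : ℝ) : ℂ) * I).im = t + v := by simp
    rw [him] at hZ
    have h12 : 12 * π * Λ ≤ |v| := by
      have h489 : (27 : ℝ) ≤ ell D ^ 489 := by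
        have h1 : (3 : ℝ) ^ 3 ≤ ell D ^ 3 := pow_le_pow_left₀ (by norm_num) hL3 3
        have h2 : ell D ^ 3 ≤ ell D ^ 489 := pow_le_pow_right₀ hL1 (by norm_num)
        nlinarith
      have h30 : 0 < ell D ^ 30 := pow_pos hL0 30
      have hsplit519 : ell D ^ 519 = ell D ^ 30 * ell D ^ 489 := by rw [← pow_add]
      have hm := mul_le_mul_of_nonneg_left h489 h30.le
      have hπ30 := mul_lt_mul_of_pos_right Real.pi_lt_four h30
      have h' : 12 * π * Λ ≤ 5 * ell D ^ 519 / 2 := by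
        rw [hsplit519, hΛdef]
        linarith
      linarith
    have hexp : Real.exp (π * |t + v| / 2) * Real.exp ((1 - v ^ 2) / (4 * Λ))
        ≤ Real.exp (1 / (4 * Λ)) * Real.exp (-(1 / (8 * Λ)) * v ^ 2) := by
      rw [← Real.exp_add, ← Real.exp_add]
      refine Real.exp_le_exp.mpr ?_
      have hvv : v ^ 2 = |v| ^ 2 := (sq_abs v).symm
      have hkey : 3 * π * |v| / 2 ≤ v ^ 2 / (8 * Λ) := by
        rw [hvv, le_div_iff₀ (by positivity)]
        have hm := mul_le_mul_of_nonneg_right h12 (abs_nonneg v)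
        calc 3 * π * |v| / 2 * (8 * Λ) = 12 * π * Λ * |v| := by ring
          _ ≤ |v| * |v| := hm
          _ = |v| ^ 2 := (sq |v|).symm
      have h1 : π * |t + v| / 2 ≤ 3 * π * |v| / 2 := by
        have hm := mul_le_mul_of_nonneg_left hy Real.pi_pos.le
        linarith
      have h2 : (1 - v ^ 2) / (4 * Λ) = 1 / (4 * Λ) - v ^ 2 / (8 * Λ) - v ^ 2 / (8 * Λ) := by
        field_simp; ring
      have h3 : -(1 / (8 * Λ)) * v ^ 2 = -(v ^ 2 / (8 * Λ)) := by ring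
      rw [h2, h3]
      linarith
    calc ‖GammaFactor.Zfac x.ψ (((σ - 1 : ℝ) : ℂ) + ((t + v : ℝ) : ℂ) * I)‖ *
          Real.exp ((1 - v ^ 2) / (4 * Λ))
        ≤ ((x.p : ℝ) ^ 2 * Real.exp (π * |t + v| / 2)) * Real.exp ((1 - v ^ 2) / (4 * Λ)) := by
          gcongr
      _ = (x.p : ℝ) ^ 2 * (Real.exp (π * |t + v| / 2) * Real.exp ((1 - v ^ 2) / (4 * Λ))) := by
          ring
      _ ≤ (x.p : ℝ) ^ 2 * (Real.exp (1 / (4 * Λ)) * Real.exp (-(1 / (8 * Λ)) * v ^ 2)) := by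
          gcongr
      _ = 1 * (x.p : ℝ) ^ 2 * Real.exp (1 / (4 * Λ)) * 1 * Real.exp (-(1 / (8 * Λ)) * v ^ 2) := by
          ring
      _ ≤ 4 * (x.p : ℝ) ^ 2 * Real.exp (1 / (4 * Λ)) * (256 * ell D ^ 1038 + 32 * Λ) *
            Real.exp (-(1 / (8 * Λ)) * v ^ 2) := by
          gcongr
          · norm_num

/-- `Z(s+w,ψ)` is continuous in `v` along `w = −1 + iv` for `1/4 ≤ σ ≤ 3/4` (no poles of
`Γ((1−z)/2)`, `Γ((2−z)/2)` there; `Γ⁻¹` is entire). [folklore] -/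
private theorem d61_continuous_Zfac_line {k : ℕ} [NeZero k] (θ : DirichletCharacter ℂ k) {s : ℂ}
    (hs2 : s.re ≤ 3 / 4) :
    Continuous fun v : ℝ => GammaFactor.Zfac θ (s + ((-1 : ℂ) + v * I)) := by
  have hz : Continuous fun v : ℝ => s + ((-1 : ℂ) + v * I) := by fun_prop
  have hπ : (π : ℂ) ≠ 0 := ofReal_ne_zero.mpr Real.pi_ne_zero
  have hk : (k : ℂ) ≠ 0 := Nat.cast_ne_zero.mpr (NeZero.ne k)
  have hcpowπ : Continuous fun v : ℝ => (π : ℂ) ^ (s + ((-1 : ℂ) + v * I) - 1 / 2) :=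
    Continuous.const_cpow (hz.sub continuous_const) (Or.inl hπ)
  have hcpowk : Continuous fun v : ℝ => (k : ℂ) ^ (-(s + ((-1 : ℂ) + v * I))) :=
    Continuous.const_cpow hz.neg (Or.inl hk)
  have hGinv : ∀ g : ℝ → ℂ, Continuous g → Continuous fun v => (Complex.Gamma (g v))⁻¹ :=
    fun g hg => Complex.differentiable_one_div_Gamma.continuous.comp hg
  have hG : ∀ g : ℝ → ℂ, Continuous g → (∀ v, 0 < (g v).re) →
      Continuous fun v => Complex.Gamma (g v) := by
    intro g hg hpos
    refine continuous_iff_continuousAt.mpr fun v => ?_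
    refine (Complex.differentiableAt_Gamma _ (fun m hm => ?_)).continuousAt.comp hg.continuousAt
    have h1 := congrArg Complex.re hm
    have h2 := hpos v
    simp at h1
    have : (0 : ℝ) ≤ m := Nat.cast_nonneg m
    linarith
  by_cases hev : θ.Even
  · have heq : (fun v : ℝ => GammaFactor.Zfac θ (s + ((-1 : ℂ) + v * I)))
        = fun v : ℝ => GammaFactor.tau θ * (π : ℂ) ^ (s + ((-1 : ℂ) + v * I) - 1 / 2) *
            (k : ℂ) ^ (-(s + ((-1 : ℂ) + v * I))) *
            Complex.Gamma ((1 - (s + ((-1 : ℂ) + v * I))) / 2) *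
            (Complex.Gamma ((s + ((-1 : ℂ) + v * I)) / 2))⁻¹ := by
      funext v
      rw [GammaFactor.Zfac, if_pos hev]
    rw [heq]
    refine (((continuous_const.mul hcpowπ).mul hcpowk).mul
      (hG _ (by fun_prop) (fun v => ?_))).mul (hGinv _ (by fun_prop))
    simp; linarith
  · have heq : (fun v : ℝ => GammaFactor.Zfac θ (s + ((-1 : ℂ) + v * I)))
        = fun v : ℝ => -I * GammaFactor.tau θ * (π : ℂ) ^ (s + ((-1 : ℂ) + v * I) - 1 / 2) *
            (k : ℂ) ^ (-(s + ((-1 : ℂ) + v * I))) *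
            Complex.Gamma ((2 - (s + ((-1 : ℂ) + v * I))) / 2) *
            (Complex.Gamma ((1 + (s + ((-1 : ℂ) + v * I))) / 2))⁻¹ := by
      funext v
      rw [GammaFactor.Zfac, if_neg hev]
    rw [heq]
    refine (((continuous_const.mul hcpowπ).mul hcpowk).mul
      (hG _ (by fun_prop) (fun v => ?_))).mul (hGinv _ (by fun_prop))
    simp; linarith

/-! ## I. The other factors of the integrands (6.2)/(6.3) on the line `u = −1` -/

/-- `|Σ_{n∈S} aₙn^{−(1−s−w)}| ≤ #S` on `w = −1 + iv` (`|aₙ| ≤ 1`, `0 ∉ S`, `σ ≤ 2`). [folklore] -/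
private theorem d61_norm_headSum_le {S : Finset ℕ} (hS : 0 ∉ S) {a : ℕ → ℂ} (ha : ∀ n, ‖a n‖ ≤ 1)
    {s : ℂ} (hs : s.re ≤ 2) (v : ℝ) :
    ‖∑ n ∈ S, a n * (n : ℂ) ^ (-(1 - s - ((-1 : ℂ) + v * I)))‖ ≤ S.card := by
  calc ‖∑ n ∈ S, a n * (n : ℂ) ^ (-(1 - s - ((-1 : ℂ) + v * I)))‖
      ≤ ∑ n ∈ S, ‖a n * (n : ℂ) ^ (-(1 - s - ((-1 : ℂ) + v * I)))‖ := norm_sum_le _ _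
    _ ≤ ∑ n ∈ S, (1 : ℝ) := by
        refine Finset.sum_le_sum fun n hn => ?_
        have hn0 : n ≠ 0 := fun h => hS (h ▸ hn)
        have hn1 : (1 : ℝ) ≤ n := by exact_mod_cast Nat.one_le_iff_ne_zero.mpr hn0
        rw [norm_mul, Complex.norm_natCast_cpow_of_pos (Nat.pos_of_ne_zero hn0)]
        have hre : (-(1 - s - ((-1 : ℂ) + v * I))).re = s.re - 2 := by simp; ring
        rw [hre]
        have h2 : (n : ℝ) ^ (s.re - 2) ≤ 1 :=
          Real.rpow_le_one_of_one_le_of_nonpos hn1 (by linarith)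
        calc ‖a n‖ * (n : ℝ) ^ (s.re - 2) ≤ 1 * 1 :=
              mul_le_mul (ha n) h2 (Real.rpow_nonneg (by positivity) _) zero_le_one
          _ = 1 := one_mul _
    _ = S.card := by simp

/-- The head sum `Σ_{n<X} ψ̄(n)n^{−(1−s−w)}` is continuous in `v` on `w = −1 + iv`. [folklore] -/
private theorem d61_continuous_headSum {D : ℕ} (x : Chr D) (X : ℝ) (s : ℂ) :
    Continuous fun v : ℝ => headSum x X s ((-1 : ℂ) + v * I) := by
  unfold headSum
  refine continuous_finsetSum _ fun n hn => ?_
  have hn0 : (n : ℂ) ≠ 0 := by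
    rw [Finset.mem_Ico] at hn
    exact Nat.cast_ne_zero.mpr (by omega)
  exact continuous_const.mul (Continuous.const_cpow (by fun_prop) (Or.inl hn0))

/-- `|P₄^w ω₁(w)/w| ≤ P₄⁻¹e^{(1−v²)/(4𝓛³⁰)}` on `w = −1 + iv`. [folklore] -/
private theorem d61_norm_kern_le {D : ℕ} (hP4 : 0 < P4 D) (v : ℝ) :
    ‖kern D ((-1 : ℂ) + v * I)‖ ≤ (P4 D)⁻¹ * Real.exp ((1 - v ^ 2) / (4 * ell D ^ 30)) := by
  rw [kern, norm_div, norm_mul, Complex.norm_cpow_eq_rpow_re_of_pos hP4]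
  have hre : ((-1 : ℂ) + v * I).re = -1 := by simp
  rw [hre, Real.rpow_neg_one]
  have hω : ‖omega1 (ell D ^ 30) ((-1 : ℂ) + v * I)‖ = Real.exp ((1 - v ^ 2) / (4 * ell D ^ 30)) := by
    have h := norm_omega1 (ell D ^ 30) (-1) v
    push_cast at h
    rw [h]
    norm_num
  have hw : 1 ≤ ‖(-1 : ℂ) + v * I‖ := by
    have h := Complex.abs_re_le_norm ((-1 : ℂ) + v * I)
    simp at h
    exact h
  rw [hω]
  exact div_le_self (by positivity) hw

/-- The Perron kernel `P₄^w ω₁(w)/w` is continuous in `v` on `w = −1 + iv`. [folklore] -/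
private theorem d61_continuous_kern {D : ℕ} (hP4 : 0 < P4 D) :
    Continuous fun v : ℝ => kern D ((-1 : ℂ) + v * I) := by
  unfold kern
  have h1 : Continuous fun v : ℝ => ((P4 D : ℝ) : ℂ) ^ ((-1 : ℂ) + v * I) :=
    Continuous.const_cpow (by fun_prop) (Or.inl (ofReal_ne_zero.mpr hP4.ne'))
  have h2 : Continuous fun v : ℝ => omega1 (ell D ^ 30) ((-1 : ℂ) + v * I) := by
    unfold omega1; fun_prop
  exact (h1.mul h2).div (by fun_prop) (fun v => d61_neg_one_add_ne_zero v)

/-- The tail `Σ_{n ≥ T³} ψ̄(n)n^{−(1−s−w)}` on `w = −1 + iv`, `σ ≤ 3/4`: continuous in `v` and bounded by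
`Σ_n n^{−5/4}` (absolute and uniform convergence, `Re(1−s−w) = 2 − σ ≥ 5/4`). [folklore] -/
private theorem d61_tailSum_line {D : ℕ} (x : Chr D) {s : ℂ} (hs : s.re ≤ 3 / 4) :
    Continuous (fun v : ℝ => tailSum x s ((-1 : ℂ) + v * I)) ∧
    ∀ v : ℝ, ‖tailSum x s ((-1 : ℂ) + v * I)‖ ≤ ∑' n : ℕ, (n : ℝ) ^ (-(5 / 4 : ℝ)) := by
  have hu : Summable fun n : ℕ => (n : ℝ) ^ (-(5 / 4 : ℝ)) :=
    Real.summable_nat_rpow.mpr (by norm_num)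
  have hT : 0 < bigT D ^ 3 := pow_pos (Real.exp_pos _) 3
  have hterm : ∀ (n : ℕ) (v : ℝ),
      ‖(if bigT D ^ 3 ≤ (n : ℝ) then
          psiBarFn x n * (n : ℂ) ^ (-(1 - s - ((-1 : ℂ) + v * I))) else 0)‖
        ≤ (n : ℝ) ^ (-(5 / 4 : ℝ)) := by
    intro n v
    split_ifs with h
    · have hn0 : n ≠ 0 := by
        rintro rfl
        simp at h
        linarith
      have hn1 : (1 : ℝ) ≤ n := by exact_mod_cast Nat.one_le_iff_ne_zero.mpr hn0
      rw [norm_mul, Complex.norm_natCast_cpow_of_pos (Nat.pos_of_ne_zero hn0)]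
      have hre : (-(1 - s - ((-1 : ℂ) + v * I))).re = s.re - 2 := by simp; ring
      rw [hre]
      have ha : ‖psiBarFn x n‖ ≤ 1 := by
        rw [psiBarFn, Complex.norm_conj]
        exact DirichletCharacter.norm_le_one _ _
      calc ‖psiBarFn x n‖ * (n : ℝ) ^ (s.re - 2) ≤ 1 * (n : ℝ) ^ (-(5 / 4 : ℝ)) :=
            mul_le_mul ha (Real.rpow_le_rpow_of_exponent_le hn1 (by linarith))
              (Real.rpow_nonneg (by positivity) _) zero_le_one
        _ = (n : ℝ) ^ (-(5 / 4 : ℝ)) := one_mul _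
    · rw [norm_zero]
      exact Real.rpow_nonneg (by positivity) _
  have hcont : ∀ n : ℕ, Continuous fun v : ℝ =>
      (if bigT D ^ 3 ≤ (n : ℝ) then
        psiBarFn x n * (n : ℂ) ^ (-(1 - s - ((-1 : ℂ) + v * I))) else 0) := by
    intro n
    by_cases h : bigT D ^ 3 ≤ (n : ℝ)
    · simp only [h, if_true]
      have hn0 : (n : ℂ) ≠ 0 := by
        have : n ≠ 0 := by
          rintro rfl
          simp at h
          linarith
        exact Nat.cast_ne_zero.mpr this
      exact continuous_const.mul (Continuous.const_cpow (by fun_prop) (Or.inl hn0))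
    · simp only [h, if_false]
      exact continuous_const
  refine ⟨?_, fun v => ?_⟩
  · unfold tailSum
    exact continuous_tsum hcont hu hterm
  · unfold tailSum
    exact tsum_of_norm_bounded hu.hasSum (fun n => hterm n v)

/-- Gaussian majorant ⇒ integrable on the line, with the two half-lines `|v| > V` small:
for continuous `f` with `|f(v)| ≤ Be^{−μv²}`,
`|∫_ℝ f − ∫_{−V}^{V} f| ≤ B√(π/(μ/2))e^{−μV²/2}`. [folklore] -/
private theorem d61_line_sub_seg_le {μ V B : ℝ} (hμ : 0 < μ) (hV : 0 ≤ V) (hB : 0 ≤ B) {f : ℝ → ℂ}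
    (hf : Continuous f) (hb : ∀ v, ‖f v‖ ≤ B * Real.exp (-μ * v ^ 2)) :
    Integrable f ∧
    ‖(∫ v, f v) - ∫ v in (-V)..V, f v‖
      ≤ B * Real.sqrt (π / (μ / 2)) * Real.exp (-(μ / 2) * V ^ 2) := by
  have hg0 : Integrable (fun v : ℝ => B * Real.exp (-μ * v ^ 2)) :=
    (integrable_exp_neg_mul_sq hμ).const_mul _
  have hint : Integrable f :=
    hg0.mono' hf.aestronglyMeasurable (ae_of_all _ hb)
  refine ⟨hint, ?_⟩
  set K : ℝ := B * Real.exp (-(μ / 2) * V ^ 2) with hK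
  have hK0 : 0 ≤ K := by positivity
  have hmeas : MeasurableSet (Ioc (-V) V) := measurableSet_Ioc
  rw [intervalIntegral.integral_of_le (by linarith : -V ≤ V), ← integral_add_compl hmeas hint,
    add_sub_cancel_left]
  have hg1 : Integrable (fun v : ℝ => K * Real.exp (-(μ / 2) * v ^ 2)) :=
    (integrable_exp_neg_mul_sq (by positivity)).const_mul _
  have hptw : ∀ v ∈ (Ioc (-V) V)ᶜ, ‖f v‖ ≤ K * Real.exp (-(μ / 2) * v ^ 2) := by
    intro v hv
    have hv' : V ^ 2 ≤ v ^ 2 := by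
      simp only [mem_compl_iff, mem_Ioc, not_and, not_le] at hv
      rcases le_or_gt v (-V) with h | h
      · nlinarith
      · have h2 := hv h
        nlinarith
    refine (hb v).trans ?_
    rw [hK, mul_assoc, ← Real.exp_add]
    refine mul_le_mul_of_nonneg_left (Real.exp_le_exp.mpr ?_) hB
    nlinarith
  calc ‖∫ v in (Ioc (-V) V)ᶜ, f v‖
      ≤ ∫ v in (Ioc (-V) V)ᶜ, K * Real.exp (-(μ / 2) * v ^ 2) :=
        norm_integral_le_of_norm_le hg1.integrableOn
          ((ae_restrict_iff' hmeas.compl).mpr (ae_of_all _ hptw))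
    _ ≤ ∫ v, K * Real.exp (-(μ / 2) * v ^ 2) :=
        setIntegral_le_integral hg1 (ae_of_all _ (fun v => by positivity))
    _ = K * Real.sqrt (π / (μ / 2)) := by rw [integral_const_mul, integral_gaussian]
    _ = B * Real.sqrt (π / (μ / 2)) * Real.exp (-(μ / 2) * V ^ 2) := by rw [hK]; ring

/-! ## J. Sizes for the edge `DedEq61` at `𝓛 ≥ 100` -/

/-- `𝓛 ≥ 100` once `D ≥ ⌈e¹⁰⁰⌉`. [cite: Zhang2022LandauSiegel, §2 (2.1)] -/
private theorem d61_hundred_le_ell {D : ℕ} (hD : ⌈Real.exp 100⌉₊ ≤ D) : 100 ≤ ell D := by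
  have h : Real.exp 100 ≤ D := le_trans (Nat.le_ceil _) (by exact_mod_cast hD)
  exact (Real.le_log_iff_exp_le (lt_of_lt_of_le (Real.exp_pos _) h)).mpr h

/-- Monotonicity of `ε = e^{−c𝓛¹⁰}` in `c`. [folklore] -/
private theorem d61_eps_mono {c c' : ℝ} (h : c ≤ c') (D : ℕ) :
    Real.exp (-c' * ell D ^ 10) ≤ Real.exp (-c * ell D ^ 10) := by
  have hℓ : 0 ≤ ell D ^ 10 := pow_nonneg (Real.log_natCast_nonneg D) _
  exact Real.exp_le_exp.mpr (by nlinarith)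

/-- The dropped piece against `ε = e^{−𝓛¹⁰/32}` (`T = e^{𝓛^{1.1}}`, `p ≤ 2P = 2e^{𝓛⁹}`,
`P₄ = PT⁻²t₀`, `𝓛 ≥ 100`):
`(2π)⁻¹·4p²e^{1/(4𝓛³⁰)}(256𝓛¹⁰³⁸ + 32𝓛³⁰)·⌈T³⌉·P₄⁻¹·√(16π𝓛³⁰)·e^{−𝓛¹⁰/16} ≤ e^{−𝓛¹⁰/32}`.
[cite: Zhang2022LandauSiegel, §6 p.32, tex L1746–1754] -/
private theorem d61_final_bound61 {L p : ℝ} (hL : 100 ≤ L) (hp0 : 0 ≤ p) (hp : p ≤ 2 * Real.exp (L ^ 9)) :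
    1 / (2 * π) *
        (4 * p ^ 2 * Real.exp (1 / (4 * L ^ 30)) * (256 * L ^ 1038 + 32 * L ^ 30) *
            (⌈Real.exp (L ^ (1.1 : ℝ)) ^ 3⌉₊ : ℝ) *
            (Real.exp (L ^ 9) / Real.exp (L ^ (1.1 : ℝ)) ^ 2 * L ^ 519)⁻¹ *
          Real.sqrt (π / (1 / (8 * L ^ 30) / 2)) *
          Real.exp (-(1 / (8 * L ^ 30) / 2) * (L ^ 20) ^ 2))
      ≤ Real.exp (-(1 / 32) * L ^ 10) := by
  set T := Real.exp (L ^ (1.1 : ℝ)) with hT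
  have hL0 : 0 < L := by linarith
  have hL1 : 1 ≤ L := by linarith
  have hT0 : 0 < T := Real.exp_pos _
  have hT1 : 1 ≤ T := Real.one_le_exp (by positivity)
  have hTL : T ≤ Real.exp (L ^ 2) := by
    refine Real.exp_le_exp.mpr ?_
    have h := Real.rpow_le_rpow_of_exponent_le hL1 (show (1.1 : ℝ) ≤ 2 by norm_num)
    rwa [Real.rpow_two] at h
  -- the factors, one by one, against exponentials
  have hceil : (⌈T ^ 3⌉₊ : ℝ) ≤ Real.exp (1 + 3 * L ^ 2) := by
    have h := Nat.ceil_lt_add_one (show 0 ≤ T ^ 3 by positivity)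
    have h1 : 1 ≤ T ^ 3 := one_le_pow₀ hT1
    have hT3 : T ^ 3 ≤ Real.exp (L ^ 2) ^ 3 := pow_le_pow_left₀ hT0.le hTL 3
    have h2 : (2 : ℝ) ≤ Real.exp 1 := by have := Real.add_one_le_exp (1 : ℝ); linarith
    calc (⌈T ^ 3⌉₊ : ℝ) ≤ 2 * T ^ 3 := by linarith
      _ ≤ Real.exp 1 * Real.exp (L ^ 2) ^ 3 := mul_le_mul h2 hT3 (by positivity) (by positivity)
      _ = Real.exp (1 + 3 * L ^ 2) := by rw [← Real.exp_nat_mul, ← Real.exp_add]; ring_nf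
  have hP4 : (Real.exp (L ^ 9) / T ^ 2 * L ^ 519)⁻¹ ≤ Real.exp (2 * L ^ 2) := by
    have h519 : (1 : ℝ) ≤ L ^ 519 := one_le_pow₀ hL1
    have h9 : (1 : ℝ) ≤ Real.exp (L ^ 9) := Real.one_le_exp (by positivity)
    rw [show (Real.exp (L ^ 9) / T ^ 2 * L ^ 519)⁻¹ = T ^ 2 / (Real.exp (L ^ 9) * L ^ 519) by
      field_simp]
    rw [div_le_iff₀ (by positivity)]
    calc T ^ 2 ≤ Real.exp (L ^ 2) ^ 2 := pow_le_pow_left₀ hT0.le hTL 2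
      _ = Real.exp (2 * L ^ 2) := by rw [← Real.exp_nat_mul]; ring_nf
      _ = Real.exp (2 * L ^ 2) * (1 * 1) := by ring
      _ ≤ Real.exp (2 * L ^ 2) * (Real.exp (L ^ 9) * L ^ 519) := by gcongr
  have hp2 : p ^ 2 ≤ Real.exp (2 + 2 * L ^ 9) := by
    have h2 : (2 : ℝ) ≤ Real.exp 1 := by have := Real.add_one_le_exp (1 : ℝ); linarith
    calc p ^ 2 ≤ (2 * Real.exp (L ^ 9)) ^ 2 := pow_le_pow_left₀ hp0 hp 2
      _ ≤ (Real.exp 1 * Real.exp (L ^ 9)) ^ 2 := by gcongr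
      _ = Real.exp (2 + 2 * L ^ 9) := by rw [← Real.exp_add, ← Real.exp_nat_mul]; ring_nf
  have hΛ1 : Real.exp (1 / (4 * L ^ 30)) ≤ Real.exp 1 := by
    refine Real.exp_le_exp.mpr ?_
    rw [div_le_iff₀ (by positivity)]
    nlinarith [one_le_pow₀ hL1 (n := 30)]
  have hLe : ∀ n : ℕ, L ^ n ≤ Real.exp (n * L) := by
    intro n
    have h := Real.add_one_le_exp L
    calc L ^ n ≤ Real.exp L ^ n := pow_le_pow_left₀ hL0.le (by linarith) n
      _ = Real.exp (n * L) := by rw [← Real.exp_nat_mul]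
  have hpoly : 256 * L ^ 1038 + 32 * L ^ 30 ≤ Real.exp (6 + 1038 * L) := by
    have h1 : L ^ 30 ≤ L ^ 1038 := pow_le_pow_right₀ hL1 (by norm_num)
    have h2 := hLe 1038
    have h3 : (288 : ℝ) ≤ Real.exp 6 := by
      have h := Real.exp_one_gt_d9
      calc (288 : ℝ) ≤ 2.7182818283 ^ 6 := by norm_num
        _ ≤ Real.exp 1 ^ 6 := pow_le_pow_left₀ (by norm_num) h.le 6
        _ = Real.exp 6 := by rw [← Real.exp_nat_mul]; norm_num
    calc 256 * L ^ 1038 + 32 * L ^ 30 ≤ 288 * L ^ 1038 := by linarith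
      _ ≤ Real.exp 6 * Real.exp ((1038 : ℕ) * L) :=
          mul_le_mul h3 h2 (by positivity) (by positivity)
      _ = Real.exp (6 + 1038 * L) := by rw [← Real.exp_add]; norm_num
  have hsqrt : Real.sqrt (π / (1 / (8 * L ^ 30) / 2)) ≤ Real.exp (5 + 30 * L) := by
    have h30 : (1 : ℝ) ≤ L ^ 30 := one_le_pow₀ hL1
    have heq : π / (1 / (8 * L ^ 30) / 2) = 16 * π * L ^ 30 := by field_simp; ring
    rw [heq]
    have h1 : 1 ≤ 16 * π * L ^ 30 := by nlinarith [Real.pi_gt_three]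
    have h64 : (64 : ℝ) ≤ Real.exp 5 := by
      have h := Real.exp_one_gt_d9
      calc (64 : ℝ) ≤ 2.7182818283 ^ 5 := by norm_num
        _ ≤ Real.exp 1 ^ 5 := pow_le_pow_left₀ (by norm_num) h.le 5
        _ = Real.exp 5 := by rw [← Real.exp_nat_mul]; norm_num
    have h2 := hLe 30
    calc Real.sqrt (16 * π * L ^ 30) ≤ 16 * π * L ^ 30 :=
          Real.sqrt_le_iff.mpr ⟨by positivity, by nlinarith⟩
      _ ≤ 64 * L ^ 30 := by nlinarith [Real.pi_lt_four]
      _ ≤ Real.exp 5 * Real.exp ((30 : ℕ) * L) := mul_le_mul h64 h2 (by positivity) (by positivity)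
      _ = Real.exp (5 + 30 * L) := by rw [← Real.exp_add]; norm_num
  have hV : Real.exp (-(1 / (8 * L ^ 30) / 2) * (L ^ 20) ^ 2) = Real.exp (-(L ^ 10 / 16)) := by
    congr 1
    field_simp
    ring
  have hπ : 1 / (2 * π) ≤ (1 : ℝ) := by
    rw [div_le_iff₀ (by positivity)]; nlinarith [Real.pi_gt_three]
  -- polynomial facts at `L ≥ 100`
  have hA : 100 * L ^ 9 ≤ L ^ 10 := by
    have : L ^ 10 = L * L ^ 9 := by ring
    rw [this]; exact mul_le_mul_of_nonneg_right hL (by positivity)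
  have hB : (10 : ℝ) ^ 14 * L ^ 2 ≤ L ^ 9 := by
    have h7 : (100 : ℝ) ^ 7 ≤ L ^ 7 := pow_le_pow_left₀ (by norm_num) hL 7
    have : L ^ 9 = L ^ 7 * L ^ 2 := by ring
    rw [this]; nlinarith [pow_pos hL0 2]
  have hC : 100 * L ≤ L ^ 2 := by nlinarith
  rw [hV]
  calc 1 / (2 * π) *
        (4 * p ^ 2 * Real.exp (1 / (4 * L ^ 30)) * (256 * L ^ 1038 + 32 * L ^ 30) *
            (⌈T ^ 3⌉₊ : ℝ) * (Real.exp (L ^ 9) / T ^ 2 * L ^ 519)⁻¹ *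
          Real.sqrt (π / (1 / (8 * L ^ 30) / 2)) * Real.exp (-(L ^ 10 / 16)))
      ≤ 1 * (4 * Real.exp (2 + 2 * L ^ 9) * Real.exp 1 * Real.exp (6 + 1038 * L) *
            Real.exp (1 + 3 * L ^ 2) * Real.exp (2 * L ^ 2) *
          Real.exp (5 + 30 * L) * Real.exp (-(L ^ 10 / 16))) := by
        gcongr
    _ = 4 * Real.exp (2 + 2 * L ^ 9 + 1 + (6 + 1038 * L) + (1 + 3 * L ^ 2) + 2 * L ^ 2 +
          (5 + 30 * L) + -(L ^ 10 / 16)) := by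
        simp only [Real.exp_add]; ring
    _ ≤ Real.exp 2 * Real.exp (2 + 2 * L ^ 9 + 1 + (6 + 1038 * L) + (1 + 3 * L ^ 2) + 2 * L ^ 2 +
          (5 + 30 * L) + -(L ^ 10 / 16)) := by
        gcongr
        have h := Real.add_one_le_exp (1 : ℝ)
        have h' : Real.exp 2 = Real.exp 1 * Real.exp 1 := by rw [← Real.exp_add]; norm_num
        nlinarith [Real.exp_pos (1 : ℝ)]
    _ = Real.exp (17 + 2 * L ^ 9 + 1068 * L + 5 * L ^ 2 - L ^ 10 / 16) := by
        rw [← Real.exp_add]; ring_nf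
    _ ≤ Real.exp (-(1 / 32) * L ^ 10) := Real.exp_le_exp.mpr (by nlinarith)

/-! ## K. The edge `DedEq61`: "The proof of (6.1) is therefore reduced to showing (6.3)" -/

/-- **The same deduction with a general error functional** (`Z22:Lem6.1.pf`, "The proof of (6.1) is
therefore reduced to showing (6.3)", §6 p. 32): for ANY non-negative `E(x,s)` in place of `E₁(s,ψ)`,
`Step6u009 → Eq62 → (6.3)[E] → (6.1)[E]` — the `E`-term is carried additively through the argument of
`dedEq61_holds` (whose proof this is, verbatim, with `E₁ ↦ E`). Used with `E(x,s) = E1main x (1 − s̄)`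
(the reflected error term of G-d08-2, `Section6IdoublePrime` / `Section6Lemma61Reflected`).
[cite: Zhang2022LandauSiegel, §6 (6.1)–(6.3) p.31–32, tex L1715–1754] -/
theorem dedEq61_of_error (E : ∀ {D : ℕ}, Chr D → ℂ → ℝ)
    (hE0 : ∀ {D : ℕ} (x : Chr D) (s : ℂ), 0 ≤ E x s) :
    Step6u009 → Eq62 →
      (∃ c : ℝ, 0 < c ∧ ∃ C : ℝ, ForAllLarge fun D _ χ => AssumptionA D χ → ∀ x : Chr D, ∀ s : ℂ,
        InRange61 D s →
          ‖lhs63 x s + GammaFactor.Zfac x.ψ s * Nchar D (psiBarFn x) (1 - s)‖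
            ≤ C * (E x s + Real.exp (-c * ell D ^ 10))) →
      ∃ c : ℝ, 0 < c ∧ ∃ C : ℝ, ForAllLarge fun D _ χ => AssumptionA D χ → ∀ x : Chr D, ∀ s : ℂ,
        InRange61 D s →
          ‖vline (integrandL x s) (-1) + GammaFactor.Zfac x.ψ s * Nchar D (psiBarFn x) (1 - s)‖
            ≤ C * (E x s + Real.exp (-c * ell D ^ 10)) := by
  intro h9 h62 h63
  obtain ⟨c₂, hc₂, C₂, h₂⟩ := h62
  obtain ⟨c₃, hc₃, C₃, h₃⟩ := h63
  refine ⟨min (min c₂ c₃) (1 / 32), lt_min (lt_min hc₂ hc₃) (by norm_num),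
    max C₃ 0 + max C₂ 0 + 1, ?_⟩
  obtain ⟨D₁, h⟩ := (h9.and h₂).and h₃
  refine ⟨max D₁ ⌈Real.exp 100⌉₊, fun D _ χ hD hq hp hA x s hs => ?_⟩
  have hD₁ : D₁ ≤ D := le_of_max_le_left hD
  have hD100 : ⌈Real.exp 100⌉₊ ≤ D := le_of_max_le_right hD
  obtain ⟨⟨h9', h62'⟩, h63'⟩ := h D χ hD₁ hq hp
  have e9 := h9' hA x s hs
  have e62 := h62' hA x s hs
  have e63 := h63' hA x s hs
  -- parameters at `𝓛 ≥ 100`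
  have hL100 : 100 ≤ ell D := d61_hundred_le_ell hD100
  have hD3 : ⌈Real.exp 3⌉₊ ≤ D :=
    le_trans (Nat.ceil_mono (Real.exp_le_exp.mpr (by norm_num))) hD100
  have hL3 : 3 ≤ ell D := d61_three_le_ell hD3
  have hL0 : 0 < ell D := by linarith
  have hL1 : 1 ≤ ell D := by linarith
  have hΛ : 0 < ell D ^ 30 := by positivity
  have hT0 : 0 < bigT D := Real.exp_pos _
  have hP0 : 0 < bigP D := Real.exp_pos _
  have ht00 : 0 < t0 D := by rw [t0]; positivity
  have hP4 : 0 < P4 D := by rw [P4]; positivity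
  have hσ1 : s.re ≤ 3 / 4 := by
    have h := (abs_lt.mp hs.1).2
    linarith [d61_two_alpha_le_quarter hL3]
  have ha : ∀ n, ‖psiBarFn x n‖ ≤ 1 := fun n => by
    rw [psiBarFn, Complex.norm_conj]
    exact DirichletCharacter.norm_le_one _ _
  have hS0 : 0 ∉ Finset.Ico 1 ⌈bigT D ^ 3⌉₊ := by simp
  obtain ⟨hPp, hpP⟩ := d61_prime_window x
  have hp0 : (0 : ℝ) ≤ x.p := by positivity
  have hp2P : (x.p : ℝ) ≤ 2 * Real.exp (ell D ^ 9) := by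
    have h68 : (ell D ^ 68)⁻¹ ≤ 1 := inv_le_one_of_one_le₀ (one_le_pow₀ hL1)
    have h1 : (x.p : ℝ) ≤ bigP D * 2 :=
      hpP.le.trans (mul_le_mul_of_nonneg_left (by linarith) hP0.le)
    rw [bigP] at h1
    linarith
  -- the objects
  set V : ℝ := ell D ^ 20 with hVdef
  set Z : ℂ := GammaFactor.Zfac x.ψ s with hZdef
  set N : ℂ := Nchar D (psiBarFn x) (1 - s) with hNdef
  set F63 : ℝ → ℂ := fun v => integrand63 x s ((-1 : ℂ) + v * I) with hF63
  set F62 : ℝ → ℂ := fun v => integrand62 x s ((-1 : ℂ) + v * I) with hF62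
  set BZ : ℝ := 4 * (x.p : ℝ) ^ 2 * Real.exp (1 / (4 * ell D ^ 30)) *
      (256 * ell D ^ 1038 + 32 * ell D ^ 30) with hBZ
  have hBZ0 : 0 ≤ BZ := by positivity
  -- pointwise on `w = −1 + iv`: `L(s+w,ψ)P₄^wω₁(w)/w = integrand63 + integrand62` (Step6u009)
  have hsplit : ∀ v : ℝ, integrandL x s ((-1 : ℂ) + v * I) = F63 v + F62 v := by
    intro v
    simp only [hF63, hF62, integrandL, integrand63, integrand62]
    rw [e9 v]
    ring
  -- Gaussian majorants
  have hZω := d61_norm_Zfac_mul_gauss_le hD3 x hs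
  have hb63 : ∀ v, ‖F63 v‖ ≤ (BZ * ⌈bigT D ^ 3⌉₊ * (P4 D)⁻¹) *
      Real.exp (-(1 / (8 * ell D ^ 30)) * v ^ 2) := by
    intro v
    have hhead : ‖headSum x (bigT D ^ 3) s ((-1 : ℂ) + v * I)‖ ≤ ⌈bigT D ^ 3⌉₊ := by
      refine (d61_norm_headSum_le hS0 ha (by linarith) v).trans ?_
      rw [Nat.card_Ico]
      exact_mod_cast Nat.sub_le _ _
    have hk := d61_norm_kern_le hP4 v
    simp only [hF63, integrand63]
    rw [norm_mul, norm_mul]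
    calc ‖GammaFactor.Zfac x.ψ (s + ((-1 : ℂ) + v * I))‖ *
          ‖headSum x (bigT D ^ 3) s ((-1 : ℂ) + v * I)‖ * ‖kern D ((-1 : ℂ) + v * I)‖
        ≤ ‖GammaFactor.Zfac x.ψ (s + ((-1 : ℂ) + v * I))‖ * ⌈bigT D ^ 3⌉₊ *
            ((P4 D)⁻¹ * Real.exp ((1 - v ^ 2) / (4 * ell D ^ 30))) := by gcongr
      _ = ‖GammaFactor.Zfac x.ψ (s + ((-1 : ℂ) + v * I))‖ *
            Real.exp ((1 - v ^ 2) / (4 * ell D ^ 30)) * ⌈bigT D ^ 3⌉₊ * (P4 D)⁻¹ := by ring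
      _ ≤ BZ * Real.exp (-(1 / (8 * ell D ^ 30)) * v ^ 2) * ⌈bigT D ^ 3⌉₊ * (P4 D)⁻¹ :=
          mul_le_mul_of_nonneg_right (mul_le_mul_of_nonneg_right (hZω v) (by positivity))
            (by positivity)
      _ = BZ * ⌈bigT D ^ 3⌉₊ * (P4 D)⁻¹ * Real.exp (-(1 / (8 * ell D ^ 30)) * v ^ 2) := by ring
  obtain ⟨htc, htb⟩ := d61_tailSum_line x hσ1
  have hU0 : 0 ≤ ∑' n : ℕ, (n : ℝ) ^ (-(5 / 4 : ℝ)) :=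
    tsum_nonneg fun n => Real.rpow_nonneg (by positivity) _
  have hb62 : ∀ v, ‖F62 v‖ ≤ (BZ * (∑' n : ℕ, (n : ℝ) ^ (-(5 / 4 : ℝ))) * (P4 D)⁻¹) *
      Real.exp (-(1 / (8 * ell D ^ 30)) * v ^ 2) := by
    intro v
    have hk := d61_norm_kern_le hP4 v
    have ht := htb v
    simp only [hF62, integrand62]
    rw [norm_mul, norm_mul]
    calc ‖GammaFactor.Zfac x.ψ (s + ((-1 : ℂ) + v * I))‖ *
          ‖tailSum x s ((-1 : ℂ) + v * I)‖ * ‖kern D ((-1 : ℂ) + v * I)‖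
        ≤ ‖GammaFactor.Zfac x.ψ (s + ((-1 : ℂ) + v * I))‖ * (∑' n : ℕ, (n : ℝ) ^ (-(5 / 4 : ℝ))) *
            ((P4 D)⁻¹ * Real.exp ((1 - v ^ 2) / (4 * ell D ^ 30))) := by gcongr
      _ = ‖GammaFactor.Zfac x.ψ (s + ((-1 : ℂ) + v * I))‖ *
            Real.exp ((1 - v ^ 2) / (4 * ell D ^ 30)) * (∑' n : ℕ, (n : ℝ) ^ (-(5 / 4 : ℝ))) *
            (P4 D)⁻¹ := by ring
      _ ≤ BZ * Real.exp (-(1 / (8 * ell D ^ 30)) * v ^ 2) * (∑' n : ℕ, (n : ℝ) ^ (-(5 / 4 : ℝ))) *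
            (P4 D)⁻¹ :=
          mul_le_mul_of_nonneg_right (mul_le_mul_of_nonneg_right (hZω v) hU0) (by positivity)
      _ = BZ * (∑' n : ℕ, (n : ℝ) ^ (-(5 / 4 : ℝ))) * (P4 D)⁻¹ *
            Real.exp (-(1 / (8 * ell D ^ 30)) * v ^ 2) := by ring
  -- continuity, integrability, and the two half-lines of the `n < T³` piece
  have hc63 : Continuous F63 := by
    show Continuous fun v : ℝ => integrand63 x s ((-1 : ℂ) + v * I)
    simp only [integrand63]
    exact ((d61_continuous_Zfac_line x.ψ hσ1).mul (d61_continuous_headSum x _ s)).mul (d61_continuous_kern hP4)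
  have hc62 : Continuous F62 := by
    show Continuous fun v : ℝ => integrand62 x s ((-1 : ℂ) + v * I)
    simp only [integrand62]
    exact ((d61_continuous_Zfac_line x.ψ hσ1).mul htc).mul (d61_continuous_kern hP4)
  have hμ : (0 : ℝ) < 1 / (8 * ell D ^ 30) := by positivity
  obtain ⟨hint63, htail⟩ :=
    d61_line_sub_seg_le hμ (by positivity : (0 : ℝ) ≤ V) (by positivity) hc63 hb63
  obtain ⟨hint62, -⟩ :=
    d61_line_sub_seg_le hμ (by positivity : (0 : ℝ) ≤ V) (by positivity) hc62 hb62
  -- the integrals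
  have hLint : vline (integrandL x s) (-1) = (1 / (2 * π) : ℂ) * ((∫ v, F63 v) + ∫ v, F62 v) := by
    rw [← integral_add hint63 hint62]
    simp only [vline, ofReal_neg, ofReal_one]
    congr 1
    exact integral_congr_ae (ae_of_all _ hsplit)
  have h63eq : lhs63 x s = (1 / (2 * π) : ℂ) * ∫ v in (-V)..V, F63 v := by
    simp only [lhs63, vseg, hF63, hVdef, ofReal_neg, ofReal_one]
  have key : vline (integrandL x s) (-1) + Z * N
      = (1 / (2 * π) : ℂ) * ((∫ v, F63 v) - ∫ v in (-V)..V, F63 v) + (lhs63 x s + Z * N) +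
        (1 / (2 * π) : ℂ) * ∫ v, F62 v := by
    rw [hLint, h63eq]; ring
  have hnorm : ‖(1 / (2 * π) : ℂ)‖ = 1 / (2 * π) := by
    rw [show (1 / (2 * π) : ℂ) = ((1 / (2 * π) : ℝ) : ℂ) by push_cast; ring]
    exact Complex.norm_of_nonneg (by positivity)
  have hπ1 : 1 / (2 * π) ≤ (1 : ℝ) := by
    rw [div_le_iff₀ (by positivity)]; nlinarith [Real.pi_gt_three]
  -- `ε`-bookkeeping
  set c : ℝ := min (min c₂ c₃) (1 / 32) with hcdef
  have hε₂ : Real.exp (-c₂ * ell D ^ 10) ≤ Real.exp (-c * ell D ^ 10) :=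
    d61_eps_mono ((min_le_left _ _).trans (min_le_left _ _)) D
  have hε₃ : Real.exp (-c₃ * ell D ^ 10) ≤ Real.exp (-c * ell D ^ 10) :=
    d61_eps_mono ((min_le_left _ _).trans (min_le_right _ _)) D
  have hε₄ : Real.exp (-(1 / 32) * ell D ^ 10) ≤ Real.exp (-c * ell D ^ 10) :=
    d61_eps_mono (min_le_right _ _) D
  -- the dropped piece
  have hdrop : 1 / (2 * π) * ‖(∫ v, F63 v) - ∫ v in (-V)..V, F63 v‖
      ≤ Real.exp (-(1 / 32) * ell D ^ 10) := by
    refine (mul_le_mul_of_nonneg_left htail (by positivity)).trans ?_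
    have h := d61_final_bound61 hL100 hp0 hp2P
    rw [hBZ, hVdef, P4, bigP, bigT, t0]
    exact h
  have hE : 0 ≤ E x s := hE0 x s
  rw [key]
  calc ‖(1 / (2 * π) : ℂ) * ((∫ v, F63 v) - ∫ v in (-V)..V, F63 v) + (lhs63 x s + Z * N) +
          (1 / (2 * π) : ℂ) * ∫ v, F62 v‖
      ≤ ‖(1 / (2 * π) : ℂ) * ((∫ v, F63 v) - ∫ v in (-V)..V, F63 v)‖ + ‖lhs63 x s + Z * N‖ +
          ‖(1 / (2 * π) : ℂ) * ∫ v, F62 v‖ := norm_add₃_le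
    _ = 1 / (2 * π) * ‖(∫ v, F63 v) - ∫ v in (-V)..V, F63 v‖ + ‖lhs63 x s + Z * N‖ +
          1 / (2 * π) * ‖∫ v, F62 v‖ := by rw [norm_mul, norm_mul, hnorm]
    _ ≤ Real.exp (-(1 / 32) * ell D ^ 10) + C₃ * (E x s + Real.exp (-c₃ * ell D ^ 10)) +
          1 / (2 * π) * (C₂ * Real.exp (-c₂ * ell D ^ 10)) := by
        gcongr
    _ ≤ (max C₃ 0 + max C₂ 0 + 1) * (E x s + Real.exp (-c * ell D ^ 10)) := by
        have hε0 : 0 < Real.exp (-c * ell D ^ 10) := Real.exp_pos _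
        have i1 : C₃ * (E x s + Real.exp (-c₃ * ell D ^ 10))
            ≤ max C₃ 0 * (E x s + Real.exp (-c * ell D ^ 10)) :=
          calc C₃ * (E x s + Real.exp (-c₃ * ell D ^ 10))
              ≤ max C₃ 0 * (E x s + Real.exp (-c₃ * ell D ^ 10)) :=
                mul_le_mul_of_nonneg_right (le_max_left _ _) (by positivity)
            _ ≤ max C₃ 0 * (E x s + Real.exp (-c * ell D ^ 10)) :=
                mul_le_mul_of_nonneg_left (by linarith) (le_max_right _ _)
        have i2 : 1 / (2 * π) * (C₂ * Real.exp (-c₂ * ell D ^ 10))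
            ≤ max C₂ 0 * (E x s + Real.exp (-c * ell D ^ 10)) :=
          calc 1 / (2 * π) * (C₂ * Real.exp (-c₂ * ell D ^ 10))
              ≤ 1 / (2 * π) * (max C₂ 0 * Real.exp (-c₂ * ell D ^ 10)) := by
                gcongr; exact le_max_left _ _
            _ ≤ 1 * (max C₂ 0 * Real.exp (-c₂ * ell D ^ 10)) :=
                mul_le_mul_of_nonneg_right hπ1 (by positivity)
            _ ≤ max C₂ 0 * (E x s + Real.exp (-c * ell D ^ 10)) := by
                rw [one_mul]
                exact mul_le_mul_of_nonneg_left (by linarith) (le_max_right _ _)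
        nlinarith [le_max_right C₃ 0, le_max_right C₂ 0]

/-- `Z22:Lem6.1.pf` EDGE `DedEq61` PROVED. §6 p. 32: "The proof of (6.1) is therefore reduced to
showing (6.3)" — the typed deduction `Section6Statements.DedEq61 : Step6u009 → Eq62 → Eq63 → Eq61`
HOLDS. The manuscript's sentence silently drops the `n < T³` part of `∫_{(−1)}` on `|v| > 𝓛²⁰` and
presupposes that the line integral splits; both are supplied here: on `w = −1 + iv` the functional
equation (`Step6u009`) gives `L(s+w,ψ)P₄^wω₁(w)/w = integrand63 + integrand62` pointwise; both pieces
are continuous and dominated by `B·e^{−v²/(8𝓛³⁰)}` (`d61_norm_Zfac_mul_gauss_le`: Stirling for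
`Im(s+w) ≥ 152`, the crude bound absorbed by `ω₁` otherwise; `|Σ_{n<T³}| ≤ ⌈T³⌉`,
`|Σ_{n≥T³}| ≤ Σn^{−5/4}`, `|P₄^wω₁(w)/w| ≤ P₄⁻¹e^{(1−v²)/(4𝓛³⁰)}`), hence integrable, and the dropped
piece is `≤ (2π)⁻¹B⌈T³⌉P₄⁻¹√(16π𝓛³⁰)e^{−𝓛¹⁰/16} ≤ e^{−𝓛¹⁰/32}` for `𝓛 ≥ 100`
(`d61_final_bound61`). Then `∫_{(−1)} + ZN = (2π)⁻¹(∫_ℝ − ∫_{−𝓛²⁰}^{𝓛²⁰})integrand63 + (lhs63 + ZN)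
+ (2π)⁻¹∫_ℝ integrand62` and (6.2), (6.3) give (6.1) with `c = min(c₂, c₃, 1/32)`,
`C = C₃⁺ + C₂⁺ + 1`, `D ≥ max(D₀, ⌈e¹⁰⁰⌉)`. No new facts; nothing about Theorems 1–2 is asserted.
[cite: Zhang2022LandauSiegel, §6 (6.1)–(6.3) p.31–32, tex L1715–1754] -/
theorem dedEq61_holds : DedEq61 :=
  dedEq61_of_error (fun x s => E1main x s) (fun x s => E1main_nonneg x s)

end Literature.NumberTheory.LFunctions.Zhang2022.Section6Statements
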